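import Literature.Algebra.Homology.GroupHomologyPermutationModule
import Mathlib.GroupTheory.GroupAction.Quotient
import Mathlib.RepresentationTheory.Invariants
import HarnessLib

/-!
# The right regular action on `H₁(Γ, k[S])` and the averaging isomorphism
# `H₁(Γ, k[S])^H ≃ H₁(Γ, k[S/H])` for a finite subgroup `H ≤ S` of order invertible in `k`

Topic `Literature/Algebra/Homology`; namespace `Literature.Algebra.Homology.PermutationCoeff`; builds on
`GroupHomologyPermutationModule` (`permRep`, `permRepObj`, `stabilizerIn`, `stabSymbol`).  Here the `Γ`-set is a
GROUP `S` on which `Γ` acts by left multiplication through `φ : Γ →* S`; right multiplication then commutes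
with the `Γ`-action.  Definitions with bodies and proved theorems; no named fact, no `sorry`, no instance.

* `rightTranslation φ g : k[S] ⟶ k[S]` (`δ_x ↦ δ_{xg⁻¹}`, a morphism of `Γ`-representations) and
  **`H1RightRep k φ : Representation k S (H₁(Γ, k[S]))`**, the right regular action on homology
  (functoriality of Mathlib's `groupHomology.map`); `H1RightRep_stabSymbol`: `g · [γ ⊗ aδ_x] = [γ ⊗ aδ_{xg⁻¹}]`.
* `quotientCoeffHom φ H : k[S] ⟶ k[S/H]` (`δ_x ↦ δ_{xH}`), invariant under `R_h`, `h ∈ H`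
  (`rightTranslation_comp_quotientCoeffHom`); the unnormalised lift `cosetLiftHom φ H : k[S/H] ⟶ k[S]`
  (`δ_{xH} ↦ Σ_{h ∈ H} δ_{xh}`, `cosetIndicator`) with `π σ' = |H|` (`quotientCoeffHom_cosetLiftHom`) and
  `σ' π = Σ_{h ∈ H} R_h` (`cosetLiftHom_quotientCoeffHom`).
* On `H₁`: `H1quot = H₁(π)`, `H1lift = H₁(σ')`, `H1quot_H1lift` (`= |H| · id`), `H1lift_H1quot`
  (`= Σ_h h·`), `H1RightRep_H1lift` (the image of `H₁(σ')` is `H`-invariant), and for `|H| ∈ kˣ`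
  (`[Invertible (Fintype.card H : k)]`) the **averaging isomorphism**
  **`invariantsEquivQuot φ H : H1Invariants k φ H ≃ₗ[k] H₁(Γ, k[S/H])`**, `z ↦ H₁(π) z`, inverse
  `w ↦ ⅟|H| · H₁(σ') w` (`H1Invariants` = Mathlib `Representation.invariants` of `H1RightRep ∘ H.subtype`).

This is the "up/down" step (S2) of the composed K-line of route BSD/TeichmullerTwistDescent (crux
`TwistedPeriodLatticeSaturation`): for `Γ = Γ₀(M)`, `S = GL₂(ℤ/p)`, `H = T̃` the diagonal torus
(`p ∤ |T̃| = (p−1)²` in `ℤ_p`), `H₁(Y(K(p)K₀(M)), ℤ_p)^{T̃} ≅ H₁(Γ₀(M), ℤ_p[G/T̃])`, which the degree-one Shapiro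
lemma (`GroupHomologyPermutationModuleShapiro`) identifies with `H₁(Γ_T, ℤ_p)`, `Γ_T ≅ Γ₀(p²M)`.
Nothing about modular curves is asserted here.

## References
* K. S. Brown, *Cohomology of Groups*, GTM 87 (1982), Ch. III §5 (`ℤG` as a bimodule, `ℤ[G/H]`), §6
  (Shapiro, functoriality), §9 (transfer / averaging for finite index). [Brown1982]
-/

noncomputable section

open CategoryTheory groupHomology Finsupp

universe u

namespace Literature.Algebra.Homology

namespace PermutationCoeff

variable {k : Type u} [CommRing k] {Γ S : Type u} [Group Γ] [Group S] (φ : Γ →* S)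
  {X : Type u} [MulAction S X]

/-! ### The right regular action on `H₁(Γ, k[S])` -/

section RightRegular

/-- Right translation `δ_x ↦ δ_{x g⁻¹}` on `k[S]` (so `(R_g f)(x) = f(xg)` on functions); it commutes with the left
`Γ`-action. [cite: Brown1982, Ch. III §5 (bimodule structure of `ℤG`)] -/
def rightTranslation (g : S) : permRepObj k φ S ⟶ permRepObj k φ S :=
  Rep.ofHom ((Finsupp.lmapDomain k k (· * g⁻¹)).intertwiningMap_of_isIntertwiningMap _ _ (fun γ f => by
    show Finsupp.lmapDomain k k (· * g⁻¹) (permRep k φ S γ f) = permRep k φ S γ _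
    rw [permRep_apply, permRep_apply]
    simp only [lmapDomain_apply, ← Finsupp.mapDomain_comp]
    congr 1
    funext x
    simp [mul_assoc]))

/-- `R_g(aδ_x) = aδ_{xg⁻¹}`. [cite: Brown1982, Ch. III §5] -/
theorem rightTranslation_single (g x : S) (a : k) :
    (rightTranslation (k := k) φ g).hom (single x a) = single (x * g⁻¹) a := by
  show Finsupp.lmapDomain k k (· * g⁻¹) (single x a) = _
  simp [mapDomain_single]

/-- `R_1 = 𝟙`. [cite: Brown1982, Ch. III §5] -/
theorem rightTranslation_one : rightTranslation (k := k) φ (1 : S) = 𝟙 _ := by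
  refine Rep.hom_ext (Representation.IntertwiningMap.ext ?_)
  ext x a
  simp [rightTranslation, mapDomain_single]

/-- `R_{gh} = R_g ∘ R_h` (in diagrammatic order `R_h ≫ R_g`). [cite: Brown1982, Ch. III §5] -/
theorem rightTranslation_mul (g h : S) :
    rightTranslation (k := k) φ (g * h) = rightTranslation φ h ≫ rightTranslation φ g := by
  refine Rep.hom_ext (Representation.IntertwiningMap.ext ?_)
  ext x a
  simp [rightTranslation, mapDomain_single, mul_inv_rev, mul_assoc]

variable (k) in
/-- **The right regular action of `S` on `H₁(Γ, k[S])`** (functoriality of `H₁` applied to right translations).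
[cite: Brown1982, Ch. III §5–§6] -/
def H1RightRep : Representation k S (H1 (permRepObj k φ S)) where
  toFun g := (groupHomology.map (MonoidHom.id Γ) (rightTranslation φ g) 1).hom
  map_one' := by rw [rightTranslation_one, groupHomology.map_id]; rfl
  map_mul' g h := by rw [rightTranslation_mul, groupHomology.map_id_comp]; rfl

/-- Unfolding `H1RightRep`: `g` acts by `H₁(R_g)`. [cite: Brown1982, Ch. III §6] -/
theorem H1RightRep_apply (g : S) :
    H1RightRep k φ g = (groupHomology.map (MonoidHom.id Γ) (rightTranslation φ g) 1).hom := by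
  simp only [H1RightRep, MonoidHom.coe_mk, OneHom.coe_mk]

/-- Right multiplication does not change the stabilizer of the LEFT action: `Γ_{xg} = Γ_x`. [cite: Brown1982, Ch. III §5] -/
theorem stabilizerIn_mul_right (x g : S) : stabilizerIn φ (x * g) = stabilizerIn φ x := by
  ext γ
  simp only [mem_stabilizerIn_iff, smul_eq_mul, ← mul_assoc, mul_left_inj]

/-- The right action permutes stabilizer symbols: `g · [γ ⊗ aδ_x] = [γ ⊗ aδ_{xg⁻¹}]`.
[cite: Brown1982, Ch. III §6 (6.5)] -/
theorem H1RightRep_stabSymbol (g x : S) (γ : stabilizerIn φ x) (a : k) :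
    H1RightRep k φ g (stabSymbol k φ x γ a) =
      stabSymbol k φ (x * g⁻¹) ⟨γ.1, (stabilizerIn_mul_right φ x g⁻¹).symm ▸ γ.2⟩ a := by
  rw [H1RightRep_apply, stabSymbol, stabSymbol]
  rw [groupHomology.H1π_comp_map_apply (A := permRepObj k φ S) (B := permRepObj k φ S)]
  congr 1
  apply Subtype.ext
  rw [coe_mapCycles₁]
  simp only [ModuleCat.hom_ofHom, LinearMap.coe_comp, Function.comp_apply, lmapDomain_apply,
    MonoidHom.coe_id, mapDomain_id, mapRange.linearMap_apply, mapRange_single]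
  congr 1
  exact rightTranslation_single φ g x a

end RightRegular

/-! ### Invariants of a subgroup of invertible order ↔ coefficients in `k[S/H]` -/

section QuotientCoeff

variable (H : Subgroup S)

/-- The projection `k[S] → k[S/H]`, `δ_x ↦ δ_{xH}` (a morphism of `Γ`-representations).
[cite: Brown1982, Ch. III §5] -/
def quotientCoeffHom : permRepObj k φ S ⟶ permRepObj k φ (S ⧸ H) :=
  Rep.ofHom ((Finsupp.lmapDomain k k (QuotientGroup.mk : S → S ⧸ H)).intertwiningMap_of_isIntertwiningMap
    _ _ (fun γ f => by
      show Finsupp.lmapDomain k k _ (permRep k φ S γ f) = permRep k φ (S ⧸ H) γ _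
      rw [permRep_apply, permRep_apply]
      simp only [lmapDomain_apply, ← Finsupp.mapDomain_comp]
      rfl))

/-- `π(aδ_x) = aδ_{xH}`. [cite: Brown1982, Ch. III §5] -/
theorem quotientCoeffHom_single (x : S) (a : k) :
    (quotientCoeffHom (k := k) φ H).hom (single x a) = single (x : S ⧸ H) a := by
  show Finsupp.lmapDomain k k _ (single x a) = _
  simp [mapDomain_single]

/-- Right translations by elements of `H` do not change the coset: `π ∘ R_h = π`. [cite: Brown1982, Ch. III §5] -/
theorem rightTranslation_comp_quotientCoeffHom (h : H) :
    rightTranslation (k := k) φ (h : S) ≫ quotientCoeffHom φ H = quotientCoeffHom φ H := by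
  refine Rep.hom_ext (Representation.IntertwiningMap.ext ?_)
  ext x a
  simp only [Rep.hom_comp, Representation.IntertwiningMap.comp_toLinearMap, LinearMap.coe_comp,
    Function.comp_apply, Representation.IntertwiningMap.toLinearMap_apply, lsingle_apply]
  rw [rightTranslation_single, quotientCoeffHom_single, quotientCoeffHom_single]
  have e : ((x * (h : S)⁻¹ : S) : S ⧸ H) = (x : S ⧸ H) := QuotientGroup.eq.2 (by simp)
  rw [e]

end QuotientCoeff

/-! ### Averaging: `H₁(Γ, k[S])^H ≅ H₁(Γ, k[S/H])` when `|H|` is invertible in `k` -/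

section Averaging

variable (H : Subgroup S)

variable (k) in
/-- The `H`-invariants of the right regular action on `H₁(Γ, k[S])`. [cite: Brown1982, Ch. III §6] -/
def H1Invariants : Submodule k (H1 (permRepObj k φ S)) :=
  Representation.invariants ((H1RightRep k φ).comp H.subtype)

/-- Membership in `H1Invariants`. [cite: Brown1982, Ch. III §6] -/
theorem mem_H1Invariants_iff (z : H1 (permRepObj k φ S)) :
    z ∈ H1Invariants k φ H ↔ ∀ h : H, H1RightRep k φ (h : S) z = z :=
  Representation.mem_invariants _ z

variable [Fintype H]

/-- The coset indicator `Σ_{h ∈ H} δ_{q̃ h} ∈ k[S]` of `q = q̃H`. [cite: Brown1982, Ch. III §5 (`ℤ[G/H] ↪ ℤ[G]` averaging)] -/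
def cosetIndicator (q : S ⧸ H) : permRepObj k φ S := ∑ h : H, single (q.out * (h : S)) (1 : k)

/-- `cosetIndicator (xH) = Σ_{h ∈ H} δ_{xh}` for any representative `x`. [cite: Brown1982, Ch. III §5] -/
theorem cosetIndicator_coe (x : S) :
    cosetIndicator (k := k) φ H (x : S ⧸ H) = ∑ h : H, single (x * (h : S)) (1 : k) := by
  obtain ⟨h₀, hh₀⟩ := QuotientGroup.mk_out_eq_mul H x
  unfold cosetIndicator
  rw [hh₀]
  exact Fintype.sum_equiv (Equiv.mulLeft h₀) _ _ (fun h => by simp [mul_assoc])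

/-- `γ · cosetIndicator q = cosetIndicator (φ(γ)q)`. [cite: Brown1982, Ch. III §5] -/
theorem permRep_cosetIndicator (γ : Γ) (q : S ⧸ H) :
    (permRepObj k φ S).ρ γ (cosetIndicator φ H q) = cosetIndicator φ H (φ γ • q) := by
  induction q using QuotientGroup.induction_on with
  | H x =>
    rw [MulAction.Quotient.smul_coe, smul_eq_mul, cosetIndicator_coe, cosetIndicator_coe, map_sum]
    refine Finset.sum_congr rfl fun h _ => ?_
    show permRep k φ S γ _ = _
    rw [permRep_single, smul_eq_mul, mul_assoc]

/-- `R_h (cosetIndicator q) = cosetIndicator q` for `h ∈ H`. [cite: Brown1982, Ch. III §5] -/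
theorem rightTranslation_cosetIndicator (h : H) (q : S ⧸ H) :
    (rightTranslation (k := k) φ (h : S)).hom (cosetIndicator φ H q) = cosetIndicator φ H q := by
  induction q using QuotientGroup.induction_on with
  | H x =>
    rw [cosetIndicator_coe, map_sum]
    exact Fintype.sum_equiv (Equiv.mulRight h⁻¹) _ _ (fun h' => by
      rw [rightTranslation_single]
      simp [mul_assoc])

/-- `π (cosetIndicator q) = |H| · δ_q`. [cite: Brown1982, Ch. III §5] -/
theorem quotientCoeffHom_cosetIndicator (q : S ⧸ H) :
    (quotientCoeffHom (k := k) φ H).hom (cosetIndicator φ H q) = (Fintype.card H : k) • single q (1 : k) := by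
  induction q using QuotientGroup.induction_on with
  | H x =>
    rw [cosetIndicator_coe, map_sum]
    have e : ∀ h : H, (quotientCoeffHom (k := k) φ H).hom (single (x * (h : S)) (1 : k)) =
        single (x : S ⧸ H) 1 := fun h => by
      rw [quotientCoeffHom_single]
      have : ((x * (h : S) : S) : S ⧸ H) = (x : S ⧸ H) := QuotientGroup.eq.2 (by simp)
      rw [this]
    rw [Finset.sum_congr rfl (fun h _ => e h), Finset.sum_const, Finset.card_univ,
      ← Nat.cast_smul_eq_nsmul k]

/-- The UNNORMALISED lift `σ' : k[S/H] → k[S]`, `aδ_q ↦ a · cosetIndicator q`, as a `k`-linear map.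
[cite: Brown1982, Ch. III §5] -/
def cosetLiftLinear : permRepObj k φ (S ⧸ H) →ₗ[k] permRepObj k φ S :=
  Finsupp.lsum k fun q => LinearMap.toSpanSingleton k _ (cosetIndicator φ H q)

/-- `σ'(aδ_q) = a · cosetIndicator q`. [cite: Brown1982, Ch. III §5] -/
theorem cosetLiftLinear_single (q : S ⧸ H) (a : k) :
    cosetLiftLinear (k := k) φ H (single q a) = a • cosetIndicator φ H q := by
  simp [cosetLiftLinear]

/-- `σ'` is `Γ`-equivariant. [cite: Brown1982, Ch. III §5] -/
theorem cosetLiftLinear_comm (γ : Γ) (f : permRepObj k φ (S ⧸ H)) :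
    cosetLiftLinear φ H ((permRepObj k φ (S ⧸ H)).ρ γ f) = (permRepObj k φ S).ρ γ (cosetLiftLinear φ H f) := by
  induction f using Finsupp.induction_linear with
  | zero => simp
  | add f₁ f₂ h₁ h₂ =>
    rw [map_add ((permRepObj k φ (S ⧸ H)).ρ γ), map_add (cosetLiftLinear φ H), h₁, h₂,
      map_add (cosetLiftLinear φ H), map_add ((permRepObj k φ S).ρ γ)]
  | single q a =>
    rw [show (permRepObj k φ (S ⧸ H)).ρ γ (single q a) = single (φ γ • q) a from permRep_single φ γ q a,
      cosetLiftLinear_single, cosetLiftLinear_single, map_smul, permRep_cosetIndicator]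

/-- The UNNORMALISED lift `σ' : k[S/H] → k[S]` as a morphism of `Γ`-representations (`⅟|H| σ'` splits `π`
when `|H| ∈ kˣ`). [cite: Brown1982, Ch. III §5] -/
def cosetLiftHom : permRepObj k φ (S ⧸ H) ⟶ permRepObj k φ S :=
  Rep.ofHom ((cosetLiftLinear φ H).intertwiningMap_of_isIntertwiningMap _ _ (cosetLiftLinear_comm φ H))

/-- `σ'(aδ_q) = a · cosetIndicator q`. [cite: Brown1982, Ch. III §5] -/
theorem cosetLiftHom_single (q : S ⧸ H) (a : k) :
    (cosetLiftHom (k := k) φ H).hom (single q a) = a • cosetIndicator φ H q :=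
  cosetLiftLinear_single φ H q a

/-- `π(σ'(f)) = |H| · f`. [cite: Brown1982, Ch. III §5] -/
theorem quotientCoeffHom_cosetLiftHom (f : permRepObj k φ (S ⧸ H)) :
    (quotientCoeffHom φ H).hom ((cosetLiftHom (k := k) φ H).hom f) = (Fintype.card H : k) • f := by
  induction f using Finsupp.induction_linear with
  | zero => simp
  | add f₁ f₂ h₁ h₂ => rw [map_add, map_add, h₁, h₂, smul_add]
  | single q a =>
    rw [cosetLiftHom_single, map_smul, quotientCoeffHom_cosetIndicator, smul_smul, mul_comm, ← smul_smul,
      smul_single, smul_eq_mul, mul_one]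

/-- `σ'(π(f)) = Σ_{h ∈ H} R_h f`. [cite: Brown1982, Ch. III §5] -/
theorem cosetLiftHom_quotientCoeffHom (f : permRepObj k φ S) :
    (cosetLiftHom (k := k) φ H).hom ((quotientCoeffHom φ H).hom f) =
      ∑ h : H, (rightTranslation φ (h : S)).hom f := by
  induction f using Finsupp.induction_linear with
  | zero => simp
  | add f₁ f₂ h₁ h₂ =>
    rw [map_add, map_add, h₁, h₂, ← Finset.sum_add_distrib]
    exact Finset.sum_congr rfl fun h _ => (map_add _ _ _).symm
  | single x a =>
    rw [quotientCoeffHom_single, cosetLiftHom_single, cosetIndicator_coe, Finset.smul_sum]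
    refine Fintype.sum_equiv (Equiv.inv H) _ _ (fun h => ?_)
    rw [rightTranslation_single, smul_single, smul_eq_mul, mul_one]
    simp

/-- `R_h ∘ σ' = σ'` for `h ∈ H`. [cite: Brown1982, Ch. III §5] -/
theorem cosetLiftHom_comp_rightTranslation (h : H) :
    cosetLiftHom (k := k) φ H ≫ rightTranslation φ (h : S) = cosetLiftHom φ H := by
  refine Rep.hom_ext (Representation.IntertwiningMap.ext ?_)
  ext q a
  simp only [Rep.hom_comp, Representation.IntertwiningMap.comp_toLinearMap, LinearMap.coe_comp,
    Function.comp_apply, Representation.IntertwiningMap.toLinearMap_apply, lsingle_apply]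
  rw [cosetLiftHom_single, map_smul, rightTranslation_cosetIndicator]

/-! #### On `H₁` -/

variable (k) in
/-- `H₁(π) : H₁(Γ, k[S]) → H₁(Γ, k[S/H])`. [cite: Brown1982, Ch. III §6] -/
def H1quot : H1 (permRepObj k φ S) →ₗ[k] H1 (permRepObj k φ (S ⧸ H)) :=
  (groupHomology.map (MonoidHom.id Γ) (quotientCoeffHom φ H) 1).hom

variable (k) in
/-- `H₁(σ') : H₁(Γ, k[S/H]) → H₁(Γ, k[S])`. [cite: Brown1982, Ch. III §6] -/
def H1lift : H1 (permRepObj k φ (S ⧸ H)) →ₗ[k] H1 (permRepObj k φ S) :=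
  (groupHomology.map (MonoidHom.id Γ) (cosetLiftHom φ H) 1).hom

/-- `H₁(π)(H₁(σ') w) = |H| · w`. [cite: Brown1982, Ch. III §6] -/
theorem H1quot_H1lift (w : H1 (permRepObj k φ (S ⧸ H))) :
    H1quot k φ H (H1lift k φ H w) = (Fintype.card H : k) • w := by
  induction w using H1_induction_on with
  | h c =>
    rw [H1lift, H1quot, groupHomology.H1π_comp_map_apply (A := permRepObj k φ (S ⧸ H))
      (B := permRepObj k φ S), groupHomology.H1π_comp_map_apply (A := permRepObj k φ S)
      (B := permRepObj k φ (S ⧸ H)), ← map_smul]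
    congr 1
    apply Subtype.ext
    rw [coe_mapCycles₁, coe_mapCycles₁, Submodule.coe_smul]
    ext γ : 1
    simp only [ModuleCat.hom_ofHom, LinearMap.coe_comp, Function.comp_apply, lmapDomain_apply,
      MonoidHom.coe_id, mapDomain_id, mapRange.linearMap_apply, mapRange_apply, Finsupp.coe_smul,
      Pi.smul_apply]
    exact quotientCoeffHom_cosetLiftHom φ H (c.1 γ)

/-- `H₁(σ')(H₁(π) z) = Σ_{h ∈ H} h · z`. [cite: Brown1982, Ch. III §6] -/
theorem H1lift_H1quot (z : H1 (permRepObj k φ S)) :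
    H1lift k φ H (H1quot k φ H z) = ∑ h : H, H1RightRep k φ (h : S) z := by
  induction z using H1_induction_on with
  | h c =>
    rw [H1lift, H1quot, groupHomology.H1π_comp_map_apply (A := permRepObj k φ S)
      (B := permRepObj k φ (S ⧸ H)), groupHomology.H1π_comp_map_apply (A := permRepObj k φ (S ⧸ H))
      (B := permRepObj k φ S)]
    simp only [H1RightRep_apply]
    conv_rhs => arg 2; ext h; rw [groupHomology.H1π_comp_map_apply (A := permRepObj k φ S)
      (B := permRepObj k φ S)]
    rw [← map_sum]
    congr 1
    apply Subtype.ext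
    rw [coe_mapCycles₁, coe_mapCycles₁, Submodule.coe_sum]
    ext γ : 1
    rw [Finsupp.finsetSum_apply]
    have e : ∀ h : H, (mapCycles₁ (MonoidHom.id Γ) (rightTranslation φ (h : S)) c).1 γ =
        (rightTranslation φ (h : S)).hom (c.1 γ) := fun h => by
      rw [coe_mapCycles₁]
      simp only [ModuleCat.hom_ofHom, LinearMap.coe_comp, Function.comp_apply, lmapDomain_apply,
        MonoidHom.coe_id, mapDomain_id, mapRange.linearMap_apply, mapRange_apply]
      rfl
    rw [Finset.sum_congr rfl (fun h _ => e h)]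
    simp only [ModuleCat.hom_ofHom, LinearMap.coe_comp, Function.comp_apply,
      lmapDomain_apply, MonoidHom.coe_id, mapDomain_id, mapRange.linearMap_apply, mapRange_apply]
    exact cosetLiftHom_quotientCoeffHom φ H (c.1 γ)

/-- The image of `H₁(σ')` is `H`-invariant. [cite: Brown1982, Ch. III §6] -/
theorem H1RightRep_H1lift (h : H) (w : H1 (permRepObj k φ (S ⧸ H))) :
    H1RightRep k φ (h : S) (H1lift k φ H w) = H1lift k φ H w := by
  rw [H1RightRep_apply, H1lift, ← LinearMap.comp_apply, ← ModuleCat.hom_comp,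
    ← groupHomology.map_id_comp, cosetLiftHom_comp_rightTranslation]

/-- `H₁(σ') w` is `H`-invariant. [cite: Brown1982, Ch. III §6] -/
theorem H1lift_mem_H1Invariants (w : H1 (permRepObj k φ (S ⧸ H))) : H1lift k φ H w ∈ H1Invariants k φ H :=
  (mem_H1Invariants_iff φ H _).2 fun h => H1RightRep_H1lift φ H h w

variable [Invertible (Fintype.card H : k)]

/-- On invariants, `⅟|H| · H₁(σ') ∘ H₁(π) = id`. [cite: Brown1982, Ch. III §6 (averaging)] -/
theorem invOf_smul_H1lift_H1quot {z : H1 (permRepObj k φ S)} (hz : z ∈ H1Invariants k φ H) :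
    ⅟(Fintype.card H : k) • H1lift k φ H (H1quot k φ H z) = z := by
  rw [H1lift_H1quot]
  have e : ∑ h : H, H1RightRep k φ (h : S) z = (Fintype.card H : k) • z := by
    rw [Finset.sum_congr rfl (fun h _ => (mem_H1Invariants_iff φ H z).1 hz h), Finset.sum_const,
      Finset.card_univ, ← Nat.cast_smul_eq_nsmul k]
  rw [e, smul_smul, invOf_mul_self, one_smul]

/-- **Invariants of a subgroup of invertible order ↔ coset coefficients.** For `H ≤ S` finite with
`|H| ∈ kˣ`, `H₁(π)` restricts to a `k`-linear equivalence `H₁(Γ, k[S])^H ≃ H₁(Γ, k[S/H])`, with inverse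
`⅟|H| · H₁(σ')`. [cite: Brown1982, Ch. III §6 Prop. 6.2 with §9 (averaging / transfer for a finite group of invertible order)] -/
def invariantsEquivQuot : H1Invariants k φ H ≃ₗ[k] H1 (permRepObj k φ (S ⧸ H)) where
  toFun z := H1quot k φ H z.1
  map_add' z₁ z₂ := by simp
  map_smul' c z := by simp
  invFun w := ⟨⅟(Fintype.card H : k) • H1lift k φ H w,
    Submodule.smul_mem _ _ (H1lift_mem_H1Invariants φ H w)⟩
  left_inv z := Subtype.ext (invOf_smul_H1lift_H1quot φ H z.2)
  right_inv w := by
    simp only [map_smul, H1quot_H1lift, smul_smul, invOf_mul_self, one_smul]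

/-- `invariantsEquivQuot` is `H₁(π)` on invariants. [cite: Brown1982, Ch. III §6] -/
theorem invariantsEquivQuot_apply (z : H1Invariants k φ H) :
    invariantsEquivQuot φ H z = H1quot k φ H z.1 := rfl

/-- The inverse of `invariantsEquivQuot` is `⅟|H| · H₁(σ')`. [cite: Brown1982, Ch. III §6] -/
theorem invariantsEquivQuot_symm_apply (w : H1 (permRepObj k φ (S ⧸ H))) :
    ((invariantsEquivQuot φ H).symm w).1 = ⅟(Fintype.card H : k) • H1lift k φ H w := rfl

end Averaging

end PermutationCoeff

end Literature.Algebra.Homology
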